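import Summits.CriticalPhenomena.PercolationContinuityZ3.Theorems.Transplant.CayleyProductRays
import Summits.CriticalPhenomena.PercolationContinuityZ3.Theorems.Transplant.CayleyGeodesicRay
import Mathlib.GroupTheory.Index
import Mathlib.GroupTheory.Schreier
import Mathlib.GroupTheory.Subgroup.Centralizer
import HarnessLib

/-!
# A CENTRAL element of infinite order in a group that is not virtually cyclic forces `p_c(Cay(Γ; S)) < 1` for EVERY generating set
# (a ray in the quotient `Γ/⟨z⟩`, lifted; no product SUBGROUP needed; torsion quotients allowed; unconditional)

builds on p205010 (kernel theorem, internal audit signed; external expert review pending) — nothing in this file uses p205010; unconditional, no node.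
Lane `prim-bschramm`, seat `prim-bschramm-p4` gen 23 (PART C3 of `P4-GENERAL.md` §45).  Helper file (`--supports stmt-CriticalPhenomena-4575 --as helper`).

THE POINT.  The two-ray theorem `CayleyProd.criticalProb_lt_one` asks for two rays `ρ₁, ρ₂` whose FIRST ray's steps commute with the second ray —
not for two commuting SUBGROUPS.  With `ρ₁ = (zⁿ)` for a CENTRAL `z` of infinite order and `ρ₂` a LIFT of a ray of the quotient `Γ/⟨z⟩`
(`CayleyRay.exists_ray_fg` on the quotient, which is infinite as soon as `⟨z⟩` has infinite index), every hypothesis is met: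
**`CayleyCentral.criticalProb_lt_one` — if `Γ = ⟨S⟩` has a central element `z` with `⟨z⟩` of infinite index and `z` of infinite order, then
`p_c(Cay(Γ; S), g) < 1` for every finite generating `S`** — e.g. every central extension `1 → ℤ → Γ → Q → 1` of an INFINITE finitely generated
group `Q` (torsion `Q` of intermediate growth included: `Γ` need not contain a product of two infinite finitely generated subgroups), every
infinite f.g. nilpotent group that is not virtually cyclic (a central element of infinite order always exists there), Seifert-fibred 3-manifold
groups over infinite base groups.  Def-free (proof lane).
[cite: MuchnikPak2001, Lemma 3 (the ray device)] [cite: BenjaminiSchramm1996, §2 Conj. 1] [cite: LyonsPeres2016, §7.4]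
-/

noncomputable section

namespace Summit.CriticalPhenomena.PercolationContinuityZ3.Theorems.Transplant
open SimpleGraph Literature.Probability.LatticeModels Literature.Probability.Percolation
open scoped Classical

namespace CayleyCentral

variable {Γ : Type} [Group Γ]

/-- **Lifting a ray from a quotient**: if `π : Γ →* Q` is surjective and `Q` has an injective ray with steps in a finite set, then `Γ` has a
sequence `ρ` with `ρ 0 = 1`, steps in a finite set, and `π ∘ ρ` injective. [folklore] -/
theorem exists_lift_ray {Q : Type} [Group Q] (π : Γ →* Q) (hπ : Function.Surjective π) (ρ' : ℕ → Q) (D' : Finset Q) (h0 : ρ' 0 = 1)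
    (hinj : Function.Injective ρ') (hstep : ∀ n, (ρ' n)⁻¹ * ρ' (n + 1) ∈ D') :
    ∃ (ρ : ℕ → Γ) (D : Finset Γ), ρ 0 = 1 ∧ Function.Injective (fun n => π (ρ n)) ∧ ∀ n, (ρ n)⁻¹ * ρ (n + 1) ∈ D := by
  -- a section of `π` and the lifted steps
  let σ : Q → Γ := Function.surjInv hπ
  have hσ : ∀ q, π (σ q) = q := Function.surjInv_eq hπ
  let ρ : ℕ → Γ := fun n => Nat.rec 1 (fun k g => g * σ ((ρ' k)⁻¹ * ρ' (k + 1))) n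
  have hρ0 : ρ 0 = 1 := rfl
  have hρs : ∀ n, ρ (n + 1) = ρ n * σ ((ρ' n)⁻¹ * ρ' (n + 1)) := fun n => rfl
  have hπρ : ∀ n, π (ρ n) = ρ' n := fun n => by
    induction n with
    | zero => rw [hρ0, map_one, h0]
    | succ n ih => rw [hρs, map_mul, ih, hσ, mul_inv_cancel_left]
  refine ⟨ρ, D'.image σ, hρ0, fun m n h => hinj (by simpa only [hπρ] using h), fun n => ?_⟩
  rw [hρs, inv_mul_cancel_left]
  exact Finset.mem_image_of_mem σ (hstep n)

/-- **THEOREM (unconditional): a central element of infinite order with `⟨z⟩` of infinite index forces `p_c(Cay(Γ; S)) < 1` for EVERY finite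
generating set `S`** (rays `zᵐ` and a lifted quotient ray; `CayleyProd.criticalProb_lt_one`). [cite: MuchnikPak2001, Lemma 3]
[cite: BenjaminiSchramm1996, §2 Conj. 1] -/
theorem criticalProb_lt_one (S : Finset Γ) (hS : Subgroup.closure (S : Set Γ) = ⊤) {z : Γ} (hz : z ∈ Subgroup.center Γ)
    (hord : ¬IsOfFinOrder z) (hinf : ¬(Subgroup.zpowers z).FiniteIndex) (g : Γ) :
    criticalProb (mulCayley (↑S : Set Γ)) g < 1 := by
  haveI : Group.FG Γ := ⟨⟨S, hS⟩⟩
  -- the quotient by the central cyclic subgroup: normal, infinite, finitely generated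
  haveI hN : (Subgroup.zpowers z).Normal := ⟨fun n hn g => by
    obtain ⟨k, rfl⟩ := Subgroup.mem_zpowers_iff.1 hn
    have hc : Commute g (z ^ k) := (show Commute g z from Subgroup.mem_center_iff.1 hz g).zpow_right k
    rw [hc.eq, mul_inv_cancel_right]
    exact Subgroup.zpow_mem _ (Subgroup.mem_zpowers z) k⟩
  haveI : Infinite (Γ ⧸ Subgroup.zpowers z) :=
    Subgroup.index_eq_zero_iff_infinite.1 (by rwa [Subgroup.finiteIndex_iff, not_not] at hinf)
  obtain ⟨ρ', D', h0', hinj', hstep'⟩ := CayleyRay.exists_ray_fg (K := Γ ⧸ Subgroup.zpowers z)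
  obtain ⟨ρ₂, D₂, -, hinj₂, hstep₂⟩ :=
    exists_lift_ray (QuotientGroup.mk' (Subgroup.zpowers z)) (QuotientGroup.mk'_surjective _) ρ' D' h0' hinj' hstep'
  refine CayleyProd.criticalProb_lt_one S hS (fun n => z ^ n) ρ₂ {z} D₂ (fun n => ?_) hstep₂ (fun d hd n => ?_) (fun m n m' n' h => ?_) g
  · rw [Finset.mem_singleton, pow_succ, inv_mul_cancel_left]
  · rw [Finset.mem_singleton.1 hd]; exact Subgroup.mem_center_iff.1 hz (ρ₂ n) |>.symm
  · -- project to the quotient: `ρ₂ n` and `ρ₂ n'` are congruent mod `⟨z⟩`, hence `n = n'`; then compare powers of `z`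
    have hq : (QuotientGroup.mk' (Subgroup.zpowers z)) (ρ₂ n) = (QuotientGroup.mk' (Subgroup.zpowers z)) (ρ₂ n') := by
      have e := congrArg (QuotientGroup.mk' (Subgroup.zpowers z)) h
      rw [map_mul, map_mul] at e
      have hz1 : ∀ k : ℕ, (QuotientGroup.mk' (Subgroup.zpowers z)) (z ^ k) = 1 := fun k =>
        (QuotientGroup.eq_one_iff _).2 (Subgroup.pow_mem _ (Subgroup.mem_zpowers z) k)
      rwa [hz1, hz1, one_mul, one_mul] at e
    have hn : n = n' := hinj₂ hq
    subst hn
    have hzz : z ^ m = z ^ m' := mul_right_cancel h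
    exact ⟨injective_pow_iff_not_isOfFinOrder.2 hord hzz, rfl⟩

/-- **Central extensions of infinite groups by `ℤ`**: if `π : Γ ↠ Q` has kernel `⟨z⟩` with `z` central of infinite order and `Q` infinite, then
`p_c(Cay(Γ; S), g) < 1` for every finite generating `S`. [cite: BenjaminiSchramm1996, §2 Conj. 1] -/
theorem criticalProb_lt_one_of_centralExtension (S : Finset Γ) (hS : Subgroup.closure (S : Set Γ) = ⊤) {Q : Type} [Group Q] [Infinite Q]
    (π : Γ →* Q) (hπ : Function.Surjective π) {z : Γ} (hz : z ∈ Subgroup.center Γ) (hord : ¬IsOfFinOrder z)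
    (hker : π.ker = Subgroup.zpowers z) (g : Γ) : criticalProb (mulCayley (↑S : Set Γ)) g < 1 := by
  refine criticalProb_lt_one S hS hz hord (fun hfi => ?_) g
  -- finite index of the kernel would make `Q ≃ Γ ⧸ ker` finite
  rw [← hker] at hfi
  haveI := hfi
  haveI : Finite (Γ ⧸ π.ker) := Subgroup.finiteIndex_iff_finite_quotient.1 hfi
  haveI : Finite Q := (QuotientGroup.quotientKerEquivOfSurjective π hπ).toEquiv.finite_iff.1 inferInstance
  exact not_finite Q

/-! ## FC version: an element of infinite order with finite-index centraliser -/

/-- **THEOREM (FC element): if `z ∈ Γ` has infinite order, FINITELY many conjugates (finite-index centraliser) and `⟨z⟩` has infinite index, then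
`p_c(Cay(Γ; S), g) < 1` for EVERY finite generating `S`** — rays `zᵐ` and a lifted ray of `C(z)/⟨z⟩` inside the centraliser (f.g. by Schreier);
no commuting SUBGROUPS needed.  E.g. every group with an infinite cyclic normal subgroup of infinite index (`ℤ ⋊ Q`, `Q` infinite f.g.), every
virtually-(central `ℤ`-extension) group. [cite: MuchnikPak2001, Lemma 3] [cite: BenjaminiSchramm1996, §2 Conj. 1] -/
theorem criticalProb_lt_one_of_finiteIndex_centralizer (S : Finset Γ) (hS : Subgroup.closure (S : Set Γ) = ⊤) {z : Γ} (hord : ¬IsOfFinOrder z)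
    (hC : (Subgroup.centralizer ({z} : Set Γ)).FiniteIndex) (hinf : ¬(Subgroup.zpowers z).FiniteIndex) (g : Γ) :
    criticalProb (mulCayley (↑S : Set Γ)) g < 1 := by
  haveI : Group.FG Γ := ⟨⟨S, hS⟩⟩
  haveI := hC
  set C := Subgroup.centralizer ({z} : Set Γ) with hCdef
  -- `z ∈ C`, central in `C`
  have hzC : z ∈ C := Subgroup.mem_centralizer_iff.2 fun h hh => by rw [Set.mem_singleton_iff.1 hh]
  let z' : C := ⟨z, hzC⟩
  have hz'c : z' ∈ Subgroup.center C := by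
    rw [Subgroup.mem_center_iff]
    intro c
    have := Subgroup.mem_centralizer_iff.1 c.2 z (Set.mem_singleton z)
    exact Subtype.ext this.symm
  have hord' : ¬IsOfFinOrder z' := fun h => hord (by
    obtain ⟨n, hn, h1⟩ := h.exists_pow_eq_one
    exact isOfFinOrder_iff_pow_eq_one.2 ⟨n, hn, by simpa using congrArg Subtype.val h1⟩)
  -- `⟨z'⟩` has infinite index in `C` (index multiplicativity)
  have hle : Subgroup.zpowers z ≤ C := (Subgroup.zpowers_le).2 hzC
  have hinf' : ¬(Subgroup.zpowers z').FiniteIndex := by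
    intro hfi
    apply hinf
    rw [Subgroup.finiteIndex_iff] at hfi ⊢
    have hmap : Subgroup.zpowers z' = (Subgroup.zpowers z).subgroupOf C := by
      ext x
      rw [Subgroup.mem_subgroupOf, Subgroup.mem_zpowers_iff, Subgroup.mem_zpowers_iff]
      constructor
      · rintro ⟨k, hk⟩; exact ⟨k, by rw [← hk]; rfl⟩
      · rintro ⟨k, hk⟩; exact ⟨k, Subtype.ext (by simpa using hk)⟩
    rw [hmap] at hfi
    have hrel : (Subgroup.zpowers z).relIndex C ≠ 0 := hfi
    rw [← Subgroup.relIndex_mul_index hle]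
    exact Nat.mul_ne_zero hrel Subgroup.FiniteIndex.index_ne_zero
  -- the quotient of `C` by `⟨z'⟩`: normal (central), infinite, finitely generated (Schreier)
  haveI hN : (Subgroup.zpowers z').Normal := ⟨fun n hn c => by
    obtain ⟨k, rfl⟩ := Subgroup.mem_zpowers_iff.1 hn
    have hc : Commute c (z' ^ k) := (show Commute c z' from Subgroup.mem_center_iff.1 hz'c c).zpow_right k
    rw [hc.eq, mul_inv_cancel_right]
    exact Subgroup.zpow_mem _ (Subgroup.mem_zpowers z') k⟩
  haveI : Infinite (C ⧸ Subgroup.zpowers z') :=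
    Subgroup.index_eq_zero_iff_infinite.1 (by rwa [Subgroup.finiteIndex_iff, not_not] at hinf')
  obtain ⟨ρ', D', h0', hinj', hstep'⟩ := CayleyRay.exists_ray_fg (K := C ⧸ Subgroup.zpowers z')
  obtain ⟨ρC, DC, -, hinjC, hstepC⟩ :=
    exists_lift_ray (QuotientGroup.mk' (Subgroup.zpowers z')) (QuotientGroup.mk'_surjective _) ρ' D' h0' hinj' hstep'
  -- push the lifted ray into `Γ`
  refine CayleyProd.criticalProb_lt_one S hS (fun n => z ^ n) (fun n => (ρC n : Γ)) {z} (DC.image Subtype.val)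
    (fun n => ?_) (fun n => ?_) (fun d hd n => ?_) (fun m n m' n' h => ?_) g
  · rw [Finset.mem_singleton, pow_succ, inv_mul_cancel_left]
  · exact Finset.mem_image.2 ⟨_, hstepC n, by simp⟩
  · rw [Finset.mem_singleton.1 hd]
    exact (Subgroup.mem_centralizer_iff.1 (ρC n).2 z (Set.mem_singleton z))
  · have h' : z' ^ m * ρC n = z' ^ m' * ρC n' := Subtype.ext (by simpa using h)
    have hq : (QuotientGroup.mk' (Subgroup.zpowers z')) (ρC n) = (QuotientGroup.mk' (Subgroup.zpowers z')) (ρC n') := by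
      have e := congrArg (QuotientGroup.mk' (Subgroup.zpowers z')) h'
      rw [map_mul, map_mul] at e
      have hz1 : ∀ k : ℕ, (QuotientGroup.mk' (Subgroup.zpowers z')) (z' ^ k) = 1 := fun k =>
        (QuotientGroup.eq_one_iff _).2 (Subgroup.pow_mem _ (Subgroup.mem_zpowers z') k)
      rwa [hz1, hz1, one_mul, one_mul] at e
    have hn : n = n' := hinjC hq
    subst hn
    have hzz : z ^ m = z ^ m' := mul_right_cancel h
    exact ⟨injective_pow_iff_not_isOfFinOrder.2 hord hzz, rfl⟩

end CayleyCentral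

end Summit.CriticalPhenomena.PercolationContinuityZ3.Theorems.Transplant
end
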